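import Literature.Geometry.Kaehler.ChainRadialMongeAmpere
import Literature.Geometry.Kaehler.ChainMongeAmpereStokes
import Literature.Geometry.GeometricMeasureTheory.RadialProfileWeight
import HarnessLib

/-!
# Radial profile weights along a holomorphic chain: Monge–Ampère densities and Stokes on balls

For a holomorphic `p`-chain `T` (`p = q + 1`) on an open `Ω ⊆ V`, a centre `a` and a profile
transition `h` at `(s, ε)` (`RadialProfiles.lean`), the **radial profile weight**
`w_h(z) = F_h(‖z - a‖²) = g(log ‖z - a‖)` (`radialWeight`; `g' = h`, `RadialProfileWeight.lean`) is
smooth on `V`, and on the carrier of `T`, off the centre, its Monge–Ampère density is the profile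
integrand of `RadialDensityTauberian.lean`:

`(dd^c w_h)(z)ᵖ(ξ_T(z)) = p! 2ᵖ ‖z-a‖^{-2p} (h(log‖z-a‖)ᵖ (1 - σ) + ½h^{p-1}h'(log‖z-a‖) σ)`,
`σ = τ_T(a,z)/‖z-a‖²` (`twoPow_ddcForm_radialWeight_orientationFrame`).

Two such weights located left of `x₀` have the same differential on `{‖z - a‖ > e^{x₀}}`
(`fderiv_radialWeight_sub_eq_zero`), hence the same `dd^c` there; so by Stokes on the `d`-closed
chain with a cut-off equal to `1` near `𝐁(a, e^{x₀})` and supported in `B(a, ρ) ⊆ Ω`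
(`ChainMongeAmpereStokes.lean`), **their Monge–Ampère integrals over `reg|T| ∩ B(a, ρ)` agree**
(`setIntegral_twoPow_ddcForm_radialWeight_eq`), as soon as `e^{x₀} < ρ`; more generally, the
Monge–Ampère integrals over `reg|T| ∩ U` of two smooth weights whose differentials agree on the
carrier in `U` off a compact subset of the open `U ⊆ Ω` agree
(`setIntegral_twoPow_ddcForm_eq_of_isCompact`, the form used on the tube of a proper
projection). Also: Monge–Ampère
densities of smooth weights are bounded on the carrier over compact sets
(`exists_bound_twoPow_ddcForm_orientationFrame`) and integrable on `reg|T| ∩ B(a, ρ)` when that set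
has finite `𝓗^{2p}`-measure (`integrableOn_twoPow_ddcForm_orientationFrame`).
[Chirka1989, §15.1 (Stokes for `∫_{A_r} ω^p`)], [Demailly, Ch. III (5.5)].

## References

* E. M. Chirka, *Complex Analytic Sets*, Kluwer 1989, §14.2 Prop. 3, §15.1 [Chirka1989].
* J.-P. Demailly, *Complex analytic and differential geometry*, Ch. III §5 (5.5).
-/

noncomputable section

open scoped Manifold Topology ENNReal InnerProductSpace ContDiff
open Set Filter MeasureTheory Metric

universe u

namespace Literature.Geometry.Kaehler

open Literature.Geometry.GeometricMeasureTheory TwoForm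

variable {V : Type u} [NormedAddCommGroup V] [InnerProductSpace ℂ V]

/-! ### `dd^c` is local -/

/-- If `u = v + c` near `z` then `dd^c u (z) = dd^c v (z)`. [folklore] -/
theorem ddcForm_eq_of_eventuallyEq_add_const {u v : V → ℝ} {z : V} {c : ℝ}
    (h : ∀ᶠ y in 𝓝 z, u y = v y + c) : ddcForm u z = ddcForm v z := by
  have hd : dcForm u =ᶠ[𝓝 z] dcForm v := by
    have h' : ∀ᶠ y in 𝓝 z, ∀ᶠ w in 𝓝 y, u w = v w + c := eventually_eventually_nhds.2 h
    filter_upwards [h'] with y hy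
    have hf : fderiv ℝ u y = fderiv ℝ v y := by
      rw [show fderiv ℝ u y = fderiv ℝ (fun w => v w + c) y from
        Filter.EventuallyEq.fderiv_eq (hy.mono fun w hw => hw), fderiv_add_const]
    ext w
    simp [dcForm_apply, hf]
  rw [ddcForm_def, ddcForm_def]
  exact hd.extDeriv_eq

/-- If `d(u - v) = 0` near `z` (for differentiable `u, v`) then `dd^c u (z) = dd^c v (z)`. [folklore] -/
theorem ddcForm_eq_of_fderiv_sub_eventuallyEq_zero {u v : V → ℝ} {z : V}
    (hu : Differentiable ℝ u) (hv : Differentiable ℝ v)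
    (h : ∀ᶠ y in 𝓝 z, fderiv ℝ (fun w => u w - v w) y = 0) : ddcForm u z = ddcForm v z := by
  have hd : dcForm u =ᶠ[𝓝 z] dcForm v := by
    filter_upwards [h] with y hy
    have hf : fderiv ℝ u y = fderiv ℝ v y := by
      rw [fderiv_fun_sub (hu y) (hv y)] at hy
      exact sub_eq_zero.1 hy
    ext w
    simp [dcForm_apply, hf]
  rw [ddcForm_def, ddcForm_def]
  exact hd.extDeriv_eq

/-! ### The radial profile weight `w_h(z) = F_h(‖z - a‖²)` -/

/-- The **radial profile weight** `w_h(z) = F_h(‖z - a‖²)` (`= g(log ‖z - a‖)`, `g' = h`) of a profile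
transition `h` at `(s, ε)`, centred at `a`. [cite: Chirka1989, §15.1] -/
def radialWeight (h : ℝ → ℝ) (s ε : ℝ) (a : V) : V → ℝ := fun z => profileWeight h s ε (‖z - a‖ ^ 2)

end Literature.Geometry.Kaehler

namespace Literature.Geometry.GeometricMeasureTheory.IsProfileTransition

open Literature.Geometry.Kaehler

variable {V : Type u} [NormedAddCommGroup V] [InnerProductSpace ℂ V] {h : ℝ → ℝ} {s ε : ℝ}

/-- The radial profile weight is smooth. [folklore] -/
theorem contDiff_radialWeight (hh : IsProfileTransition h s ε) (a : V) :
    ContDiff ℝ ∞ (radialWeight h s ε a) :=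
  hh.contDiff_profileWeight.comp ((contDiff_norm_sq ℂ).comp (contDiff_id.sub contDiff_const))

omit [InnerProductSpace ℂ V] in
/-- **Two radial profile weights located left of `x₀` differ by a constant on `{‖z - a‖ > e^{x₀}}`.**
[folklore] -/
theorem exists_radialWeight_sub_eq_const {h₁ h₂ : ℝ → ℝ} {s₁ ε₁ s₂ ε₂ x₀ : ℝ}
    (hh₁ : IsProfileTransition h₁ s₁ ε₁) (hh₂ : IsProfileTransition h₂ s₂ ε₂)
    (hs₁ : s₁ + ε₁ ≤ x₀) (hs₂ : s₂ + ε₂ ≤ x₀) (a : V) :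
    ∃ c : ℝ, ∀ z : V, Real.exp x₀ < ‖z - a‖ →
      radialWeight h₁ s₁ ε₁ a z = radialWeight h₂ s₂ ε₂ a z + c := by
  obtain ⟨c, hc⟩ := exists_profileWeight_sub_eq_const hh₁ hh₂ hs₁ hs₂
  refine ⟨c, fun z hz => ?_⟩
  have h2 : Real.exp (2 * x₀) < ‖z - a‖ ^ 2 := by
    rw [show Real.exp (2 * x₀) = Real.exp x₀ ^ 2 by rw [← Real.exp_nat_mul]; ring_nf]
    exact pow_lt_pow_left₀ hz (Real.exp_pos _).le two_ne_zero
  have := hc _ h2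
  simp only [radialWeight]
  linarith

/-- Hence **their differentials agree on `{‖z - a‖ > e^{x₀}}`**. [folklore] -/
theorem fderiv_radialWeight_sub_eq_zero {h₁ h₂ : ℝ → ℝ} {s₁ ε₁ s₂ ε₂ x₀ : ℝ}
    (hh₁ : IsProfileTransition h₁ s₁ ε₁) (hh₂ : IsProfileTransition h₂ s₂ ε₂)
    (hs₁ : s₁ + ε₁ ≤ x₀) (hs₂ : s₂ + ε₂ ≤ x₀) (a : V) {z : V} (hz : Real.exp x₀ < ‖z - a‖) :
    fderiv ℝ (fun y => radialWeight h₁ s₁ ε₁ a y - radialWeight h₂ s₂ ε₂ a y) z = 0 := by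
  obtain ⟨c, hc⟩ := exists_radialWeight_sub_eq_const hh₁ hh₂ hs₁ hs₂ a
  have hopen : IsOpen {y : V | Real.exp x₀ < ‖y - a‖} :=
    isOpen_lt continuous_const (continuous_id.sub continuous_const).norm
  have hev : (fun y => radialWeight h₁ s₁ ε₁ a y - radialWeight h₂ s₂ ε₂ a y) =ᶠ[𝓝 z] fun _ => c := by
    filter_upwards [hopen.mem_nhds hz] with y hy
    rw [hc y hy]; ring
  rw [hev.fderiv_eq, fderiv_const_apply]

/-- … **and so do their `dd^c`**. [folklore] -/
theorem ddcForm_radialWeight_eq {h₁ h₂ : ℝ → ℝ} {s₁ ε₁ s₂ ε₂ x₀ : ℝ}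
    (hh₁ : IsProfileTransition h₁ s₁ ε₁) (hh₂ : IsProfileTransition h₂ s₂ ε₂)
    (hs₁ : s₁ + ε₁ ≤ x₀) (hs₂ : s₂ + ε₂ ≤ x₀) (a : V) {z : V} (hz : Real.exp x₀ < ‖z - a‖) :
    ddcForm (radialWeight h₁ s₁ ε₁ a) z = ddcForm (radialWeight h₂ s₂ ε₂ a) z := by
  obtain ⟨c, hc⟩ := exists_radialWeight_sub_eq_const hh₁ hh₂ hs₁ hs₂ a
  have hopen : IsOpen {y : V | Real.exp x₀ < ‖y - a‖} :=
    isOpen_lt continuous_const (continuous_id.sub continuous_const).norm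
  exact ddcForm_eq_of_eventuallyEq_add_const
    (Filter.eventually_of_mem (hopen.mem_nhds hz) fun y hy => hc y hy)

end Literature.Geometry.GeometricMeasureTheory.IsProfileTransition

namespace Literature.Geometry.Kaehler

open Literature.Geometry.GeometricMeasureTheory TwoForm

variable {V : Type u} [NormedAddCommGroup V] [InnerProductSpace ℂ V]
  [FiniteDimensional ℂ V] [MeasurableSpace V] [BorelSpace V]
  {Ω : TopologicalSpace.Opens V} {q : ℕ}

namespace HolomorphicChain

/-! ### The Monge–Ampère density of a radial profile weight on the carrier -/

/-- **The Monge–Ampère density of `w_h` along `T` is the profile integrand**: at a carrier point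
`z ≠ a` of the `(q+1)`-chain `T`,
`(dd^c w_h)(z)^{q+1}(ξ_T(z)) = (q+1)! 2^{q+1} (‖z-a‖^{2(q+1)})⁻¹ (h(log‖z-a‖)^{q+1} (1 - σ) + ½h^q h'(log‖z-a‖) σ)`
with `σ = τ_T(a, z)/‖z - a‖²`. [cite: Chirka1989, §15.1] -/
theorem twoPow_ddcForm_radialWeight_orientationFrame (T : HolomorphicChain 𝓘(ℂ, V) Ω (q + 1))
    {h : ℝ → ℝ} {s ε : ℝ} (hh : IsProfileTransition h s ε) (a : V) {z : V} (hz : z ∈ T.carrier)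
    (hza : z ≠ a) :
    (ddcForm (radialWeight h s ε a) z).twoPow (q + 1) (T.orientationFrame z) =
      ((q + 1).factorial : ℝ) * 2 ^ (q + 1) * (‖z - a‖ ^ (2 * (q + 1)))⁻¹ *
        (h (Real.log ‖z - a‖) ^ (q + 1) * (1 - T.tangentialSq a z / ‖z - a‖ ^ 2) +
          profileKernel h (q + 1) (Real.log ‖z - a‖) * (T.tangentialSq a z / ‖z - a‖ ^ 2)) := by
  have hF : ContDiff ℝ 2 (profileWeight h s ε) := by
    exact_mod_cast contDiff_infty.1 hh.contDiff_profileWeight 2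
  have ht : 0 < ‖z - a‖ ^ 2 := by positivity [norm_pos_iff.2 (sub_ne_zero.2 hza)]
  rw [show radialWeight h s ε a = fun y => profileWeight h s ε (‖y - a‖ ^ 2) from rfl,
    T.twoPow_ddcForm_radial_orientationFrame hF (Nat.succ_pos q) a hz,
    hh.radial_ma_profileWeight le_add_self ht, pow_mul]
  have hlog : Real.log (‖z - a‖ ^ 2) / 2 = Real.log ‖z - a‖ := by
    rw [Real.log_pow]; push_cast; ring
  rw [hlog]

omit [FiniteDimensional ℂ V] in
/-- The `cast` of `ChainMongeAmpereStokes.lean` evaluated on the orientation frame is the plain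
value. [folklore] -/
theorem cast_apply_orientationFrame (T : HolomorphicChain 𝓘(ℂ, V) Ω (q + 1))
    (A : V [⋀^Fin (2 * (q + 1))]→L[ℝ] ℝ) (e : 2 * (q + 1) = 2 * q + 1 + 1) (z : V) :
    TwoForm.cast e A (T.orientationFrame z) = A (T.orientationFrame z) := rfl

/-! ### Boundedness and integrability of Monge–Ampère densities on the carrier -/

omit [MeasurableSpace V] [BorelSpace V] in
/-- The slots of the orientation frame have norm `≤ 1` (norm `1` at carrier points, `0` off them).
[folklore] -/
theorem norm_orientationFrame_apply_le_one [MeasurableSpace V] [BorelSpace V]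
    (T : HolomorphicChain 𝓘(ℂ, V) Ω (q + 1)) (z : V) (k : Fin (2 * (q + 1))) :
    ‖T.orientationFrame z k‖ ≤ 1 := by
  by_cases hz : z ∈ T.carrier
  · obtain ⟨u, hu, hξ⟩ := T.exists_orientationFrame_eq_complexFrame hz
    rw [hξ]
    letI : InnerProductSpace ℝ V := InnerProductSpace.complexToReal
    exact le_of_eq ((orthonormal_complexFrame hu).1 k)
  · unfold HolomorphicChain.orientationFrame
    split_ifs with h
    · letI : InnerProductSpace ℝ V := InnerProductSpace.complexToReal
      exact le_of_eq ((orthonormal_complexFrame h.choose_spec.1).1 k)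
    · simp

/-- **Monge–Ampère densities of smooth weights are bounded along the carrier over compact sets**:
`|(dd^c u)(z)ᵖ(ξ_T(z))| ≤ sup_K ‖(dd^c u)ᵖ‖`. [folklore] -/
theorem exists_bound_twoPow_ddcForm_orientationFrame (T : HolomorphicChain 𝓘(ℂ, V) Ω (q + 1))
    {u : V → ℝ} (hu : ContDiff ℝ ∞ u) {K : Set V} (hK : IsCompact K) :
    ∃ C, ∀ z ∈ K, ‖(ddcForm u z).twoPow (q + 1) (T.orientationFrame z)‖ ≤ C := by
  obtain ⟨C, hC⟩ := hK.exists_bound_of_continuousOn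
    (continuous_twoPow_ddcForm hu (q + 1)).continuousOn
  refine ⟨max C 0, fun z hz => ?_⟩
  calc ‖(ddcForm u z).twoPow (q + 1) (T.orientationFrame z)‖
      ≤ ‖(ddcForm u z).twoPow (q + 1)‖ * ∏ k, ‖T.orientationFrame z k‖ :=
        ContinuousAlternatingMap.le_opNorm _ _
    _ ≤ max C 0 * 1 := by
        refine mul_le_mul ((hC z hz).trans (le_max_left _ _)) ?_ (by positivity) (le_max_right _ _)
        calc ∏ k, ‖T.orientationFrame z k‖ ≤ ∏ _k : Fin (2 * (q + 1)), (1 : ℝ) :=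
              Finset.prod_le_prod (fun k _ => norm_nonneg _) fun k _ =>
                T.norm_orientationFrame_apply_le_one z k
          _ = 1 := by simp
    _ = max C 0 := mul_one _

/-- **Integrability of Monge–Ampère densities** of smooth weights on `reg|T| ∩ B(a, ρ)` when
`𝓗^{2p}(reg|T| ∩ 𝐁(a, ρ)) < ∞` (Lelong). [folklore] -/
theorem integrableOn_twoPow_ddcForm_orientationFrame (T : HolomorphicChain 𝓘(ℂ, V) Ω (q + 1))
    {u : V → ℝ} (hu : ContDiff ℝ ∞ u) (a : V) (ρ : ℝ)
    (hfin : (μHE[2 * (q + 1)] : Measure V) (T.carrier ∩ closedBall a ρ) < ⊤) :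
    IntegrableOn (fun z => (ddcForm u z).twoPow (q + 1) (T.orientationFrame z))
      (T.carrier ∩ ball a ρ) (μHE[2 * (q + 1)] : Measure V) := by
  obtain ⟨C, hC⟩ := T.exists_bound_twoPow_ddcForm_orientationFrame hu (isCompact_closedBall a ρ)
  have hfin' : (μHE[2 * (q + 1)] : Measure V) (T.carrier ∩ ball a ρ) < ⊤ :=
    (measure_mono (inter_subset_inter_right _ ball_subset_closedBall)).trans_lt hfin
  refine IntegrableOn.of_bound hfin' ?_ C ?_
  · exact (T.aestronglyMeasurable_twoPow_ddcForm_orientationFrame hu).mono_measure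
      (Measure.restrict_mono inter_subset_left le_rfl)
  · rw [ae_restrict_iff' (T.measurableSet_carrier.inter measurableSet_ball)]
    exact Eventually.of_forall fun z hz => hC z (ball_subset_closedBall hz.2)

/-! ### Localised Stokes: weights differing only over a compact part of an open set -/

/-- **Localised Stokes for Monge–Ampère integrals over `reg|T| ∩ U`.** Let `U ⊆ Ω` be open and
`u, v` smooth weights whose differentials agree on the carrier in `U` off a compact `K ⊆ U`
(`reg|T| ∩ U ∩ supp d(u - v) ⊆ K`; e.g. the tube of a proper projection, `u, v` functions of the
base variable agreeing off a sub-cylinder over which the chain is compact). Then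
`∫_{reg|T| ∩ U} θ_T (dd^c u)^{q+1}(ξ_T) d𝓗 = ∫_{reg|T| ∩ U} θ_T (dd^c v)^{q+1}(ξ_T) d𝓗` (given
integrability): Stokes for the transgression form cut off by `χ ∈ C_c^∞(U)`, `χ = 1` near `K`.
[cite: Chirka1989, §15.1; Harvey1977, Lemma 1.8] -/
theorem setIntegral_twoPow_ddcForm_eq_of_isCompact (T : HolomorphicChain 𝓘(ℂ, V) Ω (q + 1))
    {u v : V → ℝ} (hu : ContDiff ℝ ∞ u) (hv : ContDiff ℝ ∞ v) {U K : Set V} (hU : IsOpen U)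
    (hUΩ : U ⊆ (Ω : Set V)) (hK : IsCompact K) (hKU : K ⊆ U)
    (hsupp : T.carrier ∩ U ∩ tsupport (fderiv ℝ (fun y => u y - v y)) ⊆ K)
    (hiu : IntegrableOn (fun z => (T.density z : ℝ) *
      (ddcForm u z).twoPow (q + 1) (T.orientationFrame z)) (T.carrier ∩ U) (μHE[2 * (q + 1)] : Measure V))
    (hiv : IntegrableOn (fun z => (T.density z : ℝ) *
      (ddcForm v z).twoPow (q + 1) (T.orientationFrame z)) (T.carrier ∩ U) (μHE[2 * (q + 1)] : Measure V)) :
    ∫ z in T.carrier ∩ U, (T.density z : ℝ) * (ddcForm u z).twoPow (q + 1) (T.orientationFrame z)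
        ∂(μHE[2 * (q + 1)] : Measure V) =
      ∫ z in T.carrier ∩ U, (T.density z : ℝ) * (ddcForm v z).twoPow (q + 1) (T.orientationFrame z)
        ∂(μHE[2 * (q + 1)] : Measure V) := by
  have hu1 : Differentiable ℝ u := hu.differentiable (by simp)
  have hv1 : Differentiable ℝ v := hv.differentiable (by simp)
  obtain ⟨χ, hχ, hχc, hχU, hχ1⟩ := exists_smooth_cutoff_eq_one_nhdsSet hK hU hKU
  -- where `χ ≠ const` locally, the differentials of `u, v` agree
  have hfd : ∀ z, z ∉ tsupport (fderiv ℝ (fun y => u y - v y)) →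
      ∀ᶠ y in 𝓝 z, fderiv ℝ (fun w => u w - v w) y = 0 := fun z hz => by
    have : (tsupport (fderiv ℝ (fun y => u y - v y)))ᶜ ∈ 𝓝 z :=
      (isClosed_tsupport _).isOpen_compl.mem_nhds hz
    filter_upwards [this] with y hy using image_eq_zero_of_notMem_tsupport hy
  have hχ0 : ∀ z, z ∉ U → fderiv ℝ χ z = 0 := fun z hz => by
    have hz' : z ∉ tsupport χ := fun h => hz (hχU h)
    have hev : χ =ᶠ[𝓝 z] fun _ => 0 := by
      have : (tsupport χ)ᶜ ∈ 𝓝 z := (isClosed_tsupport _).isOpen_compl.mem_nhds hz'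
      filter_upwards [this] with y hy using image_eq_zero_of_notMem_tsupport hy
    rw [hev.fderiv_eq, fderiv_const_apply]
  have h0 : ∀ z ∈ T.carrier, fderiv ℝ χ z = 0 ∨ fderiv ℝ (fun y => u y - v y) z = 0 := by
    intro z hzc
    by_cases hzK : z ∈ K
    · left
      have hev : χ =ᶠ[𝓝 z] fun _ => 1 := hχ1.filter_mono (nhds_le_nhdsSet hzK)
      rw [hev.fderiv_eq, fderiv_const_apply]
    · by_cases hzU : z ∈ U
      · right
        have hz' : z ∉ tsupport (fderiv ℝ (fun y => u y - v y)) := fun h => hzK (hsupp ⟨⟨hzc, hzU⟩, h⟩)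
        exact (hfd z hz').self_of_nhds
      · exact Or.inl (hχ0 z hzU)
  have hst := T.setIntegral_mul_twoPow_ddcForm_sub_eq_zero hu hv hχ hχc (hχU.trans hUΩ) h0
  have hptw : ∀ z ∈ T.carrier, (T.density z : ℝ) * (χ z *
      TwoForm.cast (by omega) ((ddcForm u z).twoPow (q + 1) - (ddcForm v z).twoPow (q + 1))
        (T.orientationFrame z)) =
      U.indicator (fun z => (T.density z : ℝ) * (ddcForm u z).twoPow (q + 1) (T.orientationFrame z) -
        (T.density z : ℝ) * (ddcForm v z).twoPow (q + 1) (T.orientationFrame z)) z := by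
    intro z hzc
    rw [T.cast_apply_orientationFrame, ContinuousAlternatingMap.sub_apply]
    by_cases hzU : z ∈ U
    · rw [indicator_of_mem hzU]
      by_cases hzK : z ∈ K
      · rw [hχ1.self_of_nhdsSet z hzK]; ring
      · have hz' : z ∉ tsupport (fderiv ℝ (fun y => u y - v y)) := fun h => hzK (hsupp ⟨⟨hzc, hzU⟩, h⟩)
        rw [ddcForm_eq_of_fderiv_sub_eventuallyEq_zero hu1 hv1 (hfd z hz')]
        ring
    · rw [indicator_of_notMem hzU, image_eq_zero_of_notMem_tsupport (fun h => hzU (hχU h))]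
      ring
  rw [setIntegral_congr_fun T.measurableSet_carrier hptw, setIntegral_indicator hU.measurableSet] at hst
  rw [show (μHE[2 * q + 1 + 1] : Measure V) = μHE[2 * (q + 1)] from rfl] at hst
  rw [integral_sub hiu hiv, sub_eq_zero] at hst
  exact hst

/-! ### Stokes on balls for radial profile weights -/

/-- **Monge–Ampère integrals of radial profile weights over `reg|T| ∩ B(a, ρ)` do not depend on the
profile**, for profiles located left of `x₀` with `e^{x₀} < ρ` and `𝐁(a, ρ) ⊆ Ω`: with
`θ_T` the density of the chain,
`∫_{reg|T| ∩ B(a,ρ)} θ_T (dd^c w_{h₁})^{q+1}(ξ_T) d𝓗 = ∫_{reg|T| ∩ B(a,ρ)} θ_T (dd^c w_{h₂})^{q+1}(ξ_T) d𝓗`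
(given integrability of both). Stokes for the cut-off transgression form on the `d`-closed chain.
[cite: Chirka1989, §15.1] -/
theorem setIntegral_twoPow_ddcForm_radialWeight_eq (T : HolomorphicChain 𝓘(ℂ, V) Ω (q + 1))
    {h₁ h₂ : ℝ → ℝ} {s₁ ε₁ s₂ ε₂ x₀ : ℝ}
    (hh₁ : IsProfileTransition h₁ s₁ ε₁) (hh₂ : IsProfileTransition h₂ s₂ ε₂)
    (hs₁ : s₁ + ε₁ ≤ x₀) (hs₂ : s₂ + ε₂ ≤ x₀) {a : V} {ρ : ℝ} (hρ : Real.exp x₀ < ρ)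
    (hΩ : ball a ρ ⊆ (Ω : Set V))
    (hi₁ : IntegrableOn (fun z => (T.density z : ℝ) *
      (ddcForm (radialWeight h₁ s₁ ε₁ a) z).twoPow (q + 1) (T.orientationFrame z))
      (T.carrier ∩ ball a ρ) (μHE[2 * (q + 1)] : Measure V))
    (hi₂ : IntegrableOn (fun z => (T.density z : ℝ) *
      (ddcForm (radialWeight h₂ s₂ ε₂ a) z).twoPow (q + 1) (T.orientationFrame z))
      (T.carrier ∩ ball a ρ) (μHE[2 * (q + 1)] : Measure V)) :
    ∫ z in T.carrier ∩ ball a ρ, (T.density z : ℝ) *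
        (ddcForm (radialWeight h₁ s₁ ε₁ a) z).twoPow (q + 1) (T.orientationFrame z)
        ∂(μHE[2 * (q + 1)] : Measure V) =
      ∫ z in T.carrier ∩ ball a ρ, (T.density z : ℝ) *
        (ddcForm (radialWeight h₂ s₂ ε₂ a) z).twoPow (q + 1) (T.orientationFrame z)
        ∂(μHE[2 * (q + 1)] : Measure V) := by
  set u₁ := radialWeight h₁ s₁ ε₁ a with hu₁
  set u₂ := radialWeight h₂ s₂ ε₂ a with hu₂
  -- the cut-off: `= 1` near `𝐁(a, e^{x₀})`, supported in `B(a, ρ)`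
  obtain ⟨χ, hχ, hχc, hχΩ, hχ1⟩ := exists_smooth_cutoff_eq_one_nhdsSet
    (isCompact_closedBall a (Real.exp x₀)) isOpen_ball (closedBall_subset_ball hρ)
  have h0 : ∀ z ∈ T.carrier, fderiv ℝ χ z = 0 ∨ fderiv ℝ (fun y => u₁ y - u₂ y) z = 0 := by
    intro z _
    by_cases hz : z ∈ closedBall a (Real.exp x₀)
    · left
      have hev : χ =ᶠ[𝓝 z] fun _ => 1 := hχ1.filter_mono (nhds_le_nhdsSet hz)
      rw [hev.fderiv_eq, fderiv_const_apply]
    · right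
      rw [mem_closedBall, dist_eq_norm, not_le] at hz
      exact IsProfileTransition.fderiv_radialWeight_sub_eq_zero hh₁ hh₂ hs₁ hs₂ a hz
  have hst := T.setIntegral_mul_twoPow_ddcForm_sub_eq_zero (hh₁.contDiff_radialWeight a)
    (hh₂.contDiff_radialWeight a) hχ hχc (hχΩ.trans hΩ) h0
  -- on the carrier, `χ (MA₁ - MA₂) = 𝟙_{B(a,ρ)} (MA₁ - MA₂)`
  have hptw : ∀ z ∈ T.carrier, (T.density z : ℝ) * (χ z *
      TwoForm.cast (by omega) ((ddcForm u₁ z).twoPow (q + 1) - (ddcForm u₂ z).twoPow (q + 1))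
        (T.orientationFrame z)) =
      (ball a ρ).indicator (fun z => (T.density z : ℝ) *
        (ddcForm u₁ z).twoPow (q + 1) (T.orientationFrame z) -
        (T.density z : ℝ) * (ddcForm u₂ z).twoPow (q + 1) (T.orientationFrame z)) z := by
    intro z hz
    rw [T.cast_apply_orientationFrame, ContinuousAlternatingMap.sub_apply]
    by_cases hzb : z ∈ ball a ρ
    · rw [indicator_of_mem hzb]
      by_cases hzK : z ∈ closedBall a (Real.exp x₀)
      · rw [hχ1.self_of_nhdsSet z hzK]; ring
      · rw [mem_closedBall, dist_eq_norm, not_le] at hzK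
        rw [IsProfileTransition.ddcForm_radialWeight_eq hh₁ hh₂ hs₁ hs₂ a hzK]
        ring
    · rw [indicator_of_notMem hzb, image_eq_zero_of_notMem_tsupport (fun h => hzb (hχΩ h))]
      ring
  rw [setIntegral_congr_fun T.measurableSet_carrier hptw, setIntegral_indicator measurableSet_ball] at hst
  rw [show (μHE[2 * q + 1 + 1] : Measure V) = μHE[2 * (q + 1)] from rfl] at hst
  rw [integral_sub hi₁ hi₂, sub_eq_zero] at hst
  exact hst

end HolomorphicChain

end Literature.Geometry.Kaehler

end
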